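import Literature.AlgebraicGeometry.HodgeTheory.BettiKunnethPieceHodgeClassesHomEquiv
import Literature.AlgebraicGeometry.HodgeTheory.HodgeStructureOfHodgeModelIntegerTypeShift
import Literature.AlgebraicGeometry.HodgeTheory.BettiHodgeConjectureCurveTimesVarietyCorrespondenceCriterion
import HarnessLib

/-!
# Lemma 11.41 packaged into `Hom_HS` for EVERY bidegree: the Hodge classes of `Hⁱ(Y;ℚ) ⊗ Hʲ(Z;ℚ)` (`i + j = 2c`, `a + j = 2n`) are the morphisms of Hodge structures `Hᵃ(Z) → Hⁱ(Y)(c − n)`, `c − n ∈ ℤ`;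
# `dim_ℚ Hdgᶜ(HⁱY ⊗ HʲZ) = dim_ℚ Hom_HS(HᵃZ, HⁱY(c − n))` for all `c`; `HC(Y × Z)` ⇒ every such morphism is algebraic; **`HC(C × T)` ⟺ every `φ ∈ Hom_HS(H³T, H¹C(−1))` is induced by an algebraic class**
# (Voisin I §7.3.1 Def. 7.22, §7.3.2, §11.3.3 Thm. 11.38–11.40, Lemma 11.41, pp. 285–287, §12.1; Deligne 1971 2.1.13–2.1.14)

Family `hodge`, lane `lit-hodgefound` (Track 2 foundations library; Layers A1/A4), layer `Literature/AlgebraicGeometry/HodgeTheory`.  THEOREMS ONLY (no definition, no named fact, no instance;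
D-0026 net debt `0`).  The seat's g30-#14 proved Lemma 11.41 on the carriers for every bidegree: the Hodge classes `t` of the Künneth summand `Hⁱ(Y;ℚ) ⊗ Hʲ(Z;ℚ) ⊂ H^{2c}(Y × Z;ℚ)` are exactly
the classes whose action `(crossMap t ⊗ 1)_* : Hᵃ(Z;ℂ) → Hⁱ(Y;ℂ)` (`a + j = 2n`, `n = dim Z`) preserves rational classes, shifts types by `(c − n, c − n)` and kills the types below; g30-#17 packaged
this into genuine morphisms of `ℚ`-Hodge structures `Hᵃ(Z) → Hⁱ(Y)(r)` for NON-NEGATIVE `r = c − n` only, because the tree's carriers ⟷ `Hom_HS` dictionary (`HodgeStructureOfHodgeModelTypeShift`)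
twisted by `r : ℕ`.  The seat's g31-#1 (`HodgeStructureOfHodgeModelIntegerTypeShift`) extends the dictionary to `r : ℤ`; this file packages Lemma 11.41 for EVERY `c`, in particular for the
negative bidegrees `c < dim Z` of the Abel–Jacobi-type morphisms (`H³(T) → H¹(C)(−1)` on a curve times a threefold: `c = 2 < 3`).

WHAT IS PROVED (complex orientations; `r : ℤ` with `n + r = c`, `hw : i − 2r = a`).
* §1 **`BettiUniverse.exists_hom_tateTwist_int_of_mem_hodgeClasses_kunnethSummand`**, **`…existsUnique_…`** — every Hodge class `t` of the summand yields a unique `φ_t ∈ Hom_HS(Hᵃ(Z), Hⁱ(Y)(r))`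
  (into `((BettiUniverse.hodge hHD hY i).tateTwist r).cast hw`) with `φ_t(v) ⊗ 1 = (crossMap t ⊗ 1)_*(v ⊗ 1)`.
* §2 **`BettiUniverse.exists_mem_hodgeClasses_corrAction_crossMap_eq_ofRatClass_hom_int`**, **`…existsUnique_…`** — conversely every `φ ∈ Hom_HS(Hᵃ(Z), Hⁱ(Y)(r))` is `φ_t` for a unique Hodge class `t`.
* §3 **`BettiUniverse.finrank_hodgeClasses_kunnethSummand_eq_finrank_hom_tateTwist_int`** — `dim_ℚ Hdgᶜ(Hⁱ(Y) ⊗ Hʲ(Z)) = dim_ℚ Hom_HS(Hᵃ(Z), Hⁱ(Y)(r))` for every `c`; and the duality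
  **`BettiUniverse.finrank_hom_tateTwist_eq_finrank_hom_tateTwist_int_swap`**: `dim_ℚ Hom_HS(Hⁱ(Y), Hʲ(Z)(s)) = dim_ℚ Hom_HS(H^{2n−j}(Z), Hⁱ(Y)(r))` (`j − 2s = i`), all signs.
* §4 **`BettiUniverse.exists_algebraic_corrAction_eq_ofRatClass_hom_int_of_hodgeConjectureFor`** — `HC(Y × Z)` ⇒ every `φ ∈ Hom_HS(Hᵃ(Z), Hⁱ(Y)(r))`, any sign of `r`, is the action of a rational
  ALGEBRAIC class of `H^{2c}(Y × Z)`: `(γ ⊗ 1)_*(v ⊗ 1) = φ(v) ⊗ 1`.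
* §5 **`BettiUniverse.forall_hodgeClasses_exists_algebraic_corrAction_eq_iff_forall_hom_tateTwist_int`** — for one Künneth piece: «every Hodge class of the summand acts as some rational algebraic class
  does» ⟺ «every `φ ∈ Hom_HS(Hᵃ(Z), Hⁱ(Y)(r))` is induced by a rational algebraic class» (the conversion behind every `Hom_HS` criterion).
* §6 **`BettiUniverse.hodgeConjectureFor_curve_tensor_threefold_iff_forall_hom_tateTwist_exists_algebraic`** — for a smooth projective curve `C` and threefold `T`: **`HC(C × T)` iff every morphism of
  `ℚ`-Hodge structures `φ : H³(T) → H¹(C)(−1)` is induced by a rational algebraic class `γ ∈ H⁴(C × T;ℚ)`: `(γ ⊗ 1)_*(v ⊗ 1) = φ(v) ⊗ 1` for all `v ∈ H³(T;ℚ)`** (these `φ` are the morphisms of Hodge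
  structures underlying the homomorphisms `J²(T) → J(C)` of intermediate Jacobians; g30-#7's ∃-form + §5 with `r = −1`); and for a curve and an `n`-fold `Z` with `HC(Z)`:
  **`BettiUniverse.hodgeConjectureFor_curve_tensor_iff_forall_hom_tateTwist_exists_algebraic`** (pieces `H¹(C) ⊗ Hʲ(Z)`, `j` odd, `3 ≤ j ≤ n`, twist `c − n ≤ 0`).

THE PRINTS.  C. Voisin (2002) [VoisinHodgeI2002] §7.1.1; §7.3.1 Def. 7.22; §7.3.2; §11.3.3 Thm. 11.38–11.40, Lemma 11.41 («the Hodge classes of `H^k(Y) ⊗ H^l(Z)` … are identified with the morphisms of Hodge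
structures … of bidegree …») and pp. 285–287; §12.1 (intermediate Jacobians).  C. Voisin (2025) [Voisin2025] §3.2.1 (12)–(14), Prop. 3.8, Cor. 3.9.  P. Deligne (2000/2006) [Deligne2000] §1.  P. Deligne (1971)
[DeligneHodgeII1971] 2.1.13–2.1.14, Thm. 2.3.5.  A. Hatcher (2002) [HatcherAT2002] §3.3 Prop. 3.38.

THE OBJECTS (all the tree's).  `corrAction complexOrientationFamily hY hZ hab`, `BettiUniverse.crossMap`, `BettiUniverse.kunnethSummand`, `BettiUniverse.hodge hHD hX k`, `HodgeStructure.Hom`, `tateTwist` (by `r : ℤ`), `cast`,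
`hodgeClasses`, `ofRatClass`, `ofRatClassBaseChange`, `algebraicClasses`, `HodgeConjectureFor`, `BettiUniverse.realHodgeModel`, `hodgePQ_independent_of_hodgeModel_holds`; the seat's g31-#1
`HodgeModel.exists_hom_of_typeShift_int`, `HodgeModel.exists_carrier_of_hom_int`, `HodgeModel.piece_tateTwist_cast_int`; g30-#14 `…typeShift_corrAction_crossMap_of_mem_hodgeClasses`,
`…exists_mem_hodgeClasses_corrAction_crossMap_eq_of_typeShift`, `…mem_hodgeClasses_kunnethSummand_iff_isOfHodgeType`; g30-#13 `BettiUniverse.span_range_ofRatClass_eq_top`; g30-#2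
`BettiUniverse.corrAction_crossMap_injective`, `BettiUniverse.eq_zero_of_corrAction_crossMap_eq_zero`; `BettiUniverse.finrank_hodgeClasses_tensor_hodge_eq_finrank_hom_tateTwist`; g30-#7
`BettiUniverse.hodgeConjectureFor_curve_tensor_threefold_iff_forall_exists_corrAction_eq`, `BettiUniverse.hodgeConjectureFor_curve_tensor_iff_forall_exists_corrAction_eq`.

DEVIATIONS / SCOPE.  Complex orientations.  No `LinearEquiv` is defined (theorem-only file): the bijection `t ↦ φ_t` is recorded as two `∃!` statements and the `finrank` identity.  The non-negative
statements of g30-#17/#18 are the case `r : ℕ` (same proofs through the tree's `ℕ`-dictionary).  No definitions.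

## References
* [VoisinHodgeI2002] C. Voisin, *Hodge Theory and Complex Algebraic Geometry I* (2002) — §7.1.1; §7.3.1 Def. 7.22; §7.3.2; §11.3.3 Thm. 11.38–11.40, Lemma 11.41, pp. 285–287; §12.1.
* [Voisin2025] C. Voisin, *Cycle classes on algebraic varieties* (2025) — §3.2.1 (12)–(14), Prop. 3.8, Cor. 3.9.
* [Deligne2000] P. Deligne, *The Hodge conjecture* (Clay problem description) — §1.
* [DeligneHodgeII1971] P. Deligne, *Théorie de Hodge II* (1971) — 2.1.13–2.1.14, Thm. 2.3.5.
* [HatcherAT2002] A. Hatcher, *Algebraic Topology* (2002) — §3.3 Prop. 3.38.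

## Provenance
Lane `lit-hodgefound` (Hodge path, Track 2), prover seat `lit-hodgefound-p29` (generation 31), self-proposed row g31-#2 (gen-30 free pointer (a): Lemma 11.41 packaged into `Hom_HS` for every sign of
`c − dim Z`, from g31-#1 + g30-#14; the `Hom_HS(H³T, H¹C(−1))` form of `HC(C × T)`).
-/

noncomputable section

open scoped TensorProduct
open CategoryTheory MonoidalCategory CartesianMonoidalCategory Module Finset
open Literature.AlgebraicTopology.SingularHomology
open Literature.Geometry.Kaehler

namespace Literature.AlgebraicGeometry.HodgeTheory

open Literature.AlgebraicGeometry.Motives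
open Literature.AlgebraicGeometry.Motives.HodgeStructure

variable {m n d : ℕ} {Y Z C T : SchemeOver ℂ}

variable [HodgeTensorFacts.{0, 0}]

/-! ### §1 From a Hodge class of the summand to a morphism into the integer Tate twist -/

/-- **A Hodge class `t` of `Hⁱ(Y;ℚ) ⊗ Hʲ(Z;ℚ)` (`i + j = 2c`, `a + 2c = i + 2n`, `n + r = c` with `r : ℤ` of any sign) defines a morphism of Hodge structures `φ_t : Hᵃ(Z) → Hⁱ(Y)(r)` with
`φ_t(v) ⊗ 1 = (crossMap t ⊗ 1)_*(v ⊗ 1)`**: the action preserves rational classes, shifts types by `(r, r)` and kills the types below (g30-#14) — the carrier description of a morphism into the integer Tate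
twist (g31-#1 `HodgeModel.exists_hom_of_typeShift_int`). [cite: VoisinHodgeI2002, §7.3.1 Def. 7.22, §7.3.2, §11.3.3 Lemma 11.41 and p. 286] [cite: DeligneHodgeII1971, 2.1.13–2.1.14] -/
theorem BettiUniverse.exists_hom_tateTwist_int_of_mem_hodgeClasses_kunnethSummand (hHD : exists_isReal_hodgeModel) (hY : IsSmoothProjective m Y) (hZ : IsSmoothProjective n Z) {c i j a : ℕ} {r : ℤ}
    (hij : i + j = 2 * c) (hab : a + 2 * c = i + 2 * n) (hr : ((n : ℕ) : ℤ) + r = ((c : ℕ) : ℤ)) (hw : ((i : ℕ) : ℤ) - 2 * r = ((a : ℕ) : ℤ))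
    {t : bettiCohomology Y i ⊗[ℚ] bettiCohomology Z j} (ht : t ∈ (BettiUniverse.kunnethSummand hHD hY hZ (2 * c) ⟨(i, j), mem_antidiagonal.2 hij⟩).hodgeClasses c) :
    ∃ φ : HodgeStructure.Hom (BettiUniverse.hodge hHD hZ a) (((BettiUniverse.hodge hHD hY i).tateTwist r).cast hw),
      ∀ v, ofRatClass (ComplexPoints Y) i (φ.toLinearMap v) =
        corrAction complexOrientationFamily hY hZ hab (ofRatClass (ComplexPoints (Y ⊗ Z)) (2 * c) (BettiUniverse.crossMap Y Z hij t)) (ofRatClass (ComplexPoints Z) a v) := by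
  have hI := hodgePQ_independent_of_hodgeModel_holds
  obtain ⟨hR, hS, hV⟩ := BettiUniverse.typeShift_corrAction_crossMap_of_mem_hodgeClasses hHD hY hZ hij hab ht
  set f := corrAction complexOrientationFamily hY hZ hab (ofRatClass (ComplexPoints (Y ⊗ Z)) (2 * c) (BettiUniverse.crossMap Y Z hij t)) with hf
  have hfH : ∀ (p q : ℕ), p + q = a → ∀ u, (BettiUniverse.realHodgeModel hHD hZ).pullback a u ∈ (BettiUniverse.realHodgeModel hHD hZ).hodgePQ a p q →
      ∀ p' q' : ℕ, ((p : ℕ) : ℤ) + r = ((p' : ℕ) : ℤ) → ((q : ℕ) : ℤ) + r = ((q' : ℕ) : ℤ) →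
        (BettiUniverse.realHodgeModel hHD hY).pullback i (f u) ∈ (BettiUniverse.realHodgeModel hHD hY).hodgePQ i p' q' := by
    intro p q _ u hu p' q' hp' hq'
    obtain ⟨A', hA'⟩ := hS p q u ⟨_, hu⟩ p' q' (by omega) (by omega)
    exact hI m Y hY A' _ i p' q' _ hA'
  have hf0 : ∀ (p q : ℕ), p + q = a → ∀ u, (BettiUniverse.realHodgeModel hHD hZ).pullback a u ∈ (BettiUniverse.realHodgeModel hHD hZ).hodgePQ a p q →
      ((p : ℕ) : ℤ) + r < 0 ∨ ((q : ℕ) : ℤ) + r < 0 → f u = 0 :=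
    fun p q _ u hu hlt ↦ hV p q u ⟨_, hu⟩ (by omega)
  obtain ⟨φ, hφ⟩ := HodgeModel.exists_hom_of_typeShift_int hZ hY (BettiUniverse.realHodgeModel hHD hZ) (BettiUniverse.realHodgeModel_isHodgeSymmetric hHD hZ)
    (BettiUniverse.realHodgeModel hHD hY) (BettiUniverse.realHodgeModel_isHodgeSymmetric hHD hY) (show ((a : ℕ) : ℤ) + 2 * r = ((i : ℕ) : ℤ) by omega)
    (((BettiUniverse.hodge hHD hY i).tateTwist r).cast hw)
    (HodgeModel.piece_tateTwist_cast_int hY (BettiUniverse.realHodgeModel hHD hY) (BettiUniverse.realHodgeModel_isHodgeSymmetric hHD hY) hw) f hR hfH hf0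
  refine ⟨φ, fun v ↦ ?_⟩
  have h := hφ (1 ⊗ₜ v)
  rwa [LinearMap.baseChange_tmul, ofRatClassBaseChange_tmul, ofRatClassBaseChange_tmul, one_smul, one_smul] at h

/-- **… and `φ_t` is unique** (a morphism of Hodge structures is its `ℚ`-linear map; `⊗ 1` is injective). [cite: DeligneHodgeII1971, Thm. 2.3.5] [cite: VoisinHodgeI2002, §7.1.1] -/
theorem BettiUniverse.existsUnique_hom_tateTwist_int_of_mem_hodgeClasses_kunnethSummand (hHD : exists_isReal_hodgeModel) (hY : IsSmoothProjective m Y) (hZ : IsSmoothProjective n Z) {c i j a : ℕ}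
    {r : ℤ} (hij : i + j = 2 * c) (hab : a + 2 * c = i + 2 * n) (hr : ((n : ℕ) : ℤ) + r = ((c : ℕ) : ℤ)) (hw : ((i : ℕ) : ℤ) - 2 * r = ((a : ℕ) : ℤ))
    {t : bettiCohomology Y i ⊗[ℚ] bettiCohomology Z j} (ht : t ∈ (BettiUniverse.kunnethSummand hHD hY hZ (2 * c) ⟨(i, j), mem_antidiagonal.2 hij⟩).hodgeClasses c) :
    ∃! φ : HodgeStructure.Hom (BettiUniverse.hodge hHD hZ a) (((BettiUniverse.hodge hHD hY i).tateTwist r).cast hw),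
      ∀ v, ofRatClass (ComplexPoints Y) i (φ.toLinearMap v) =
        corrAction complexOrientationFamily hY hZ hab (ofRatClass (ComplexPoints (Y ⊗ Z)) (2 * c) (BettiUniverse.crossMap Y Z hij t)) (ofRatClass (ComplexPoints Z) a v) := by
  obtain ⟨φ, hφ⟩ := BettiUniverse.exists_hom_tateTwist_int_of_mem_hodgeClasses_kunnethSummand hHD hY hZ hij hab hr hw ht
  refine ⟨φ, hφ, fun ψ hψ ↦ HodgeStructure.Hom.toLinearMap_injective (LinearMap.ext fun v ↦ ofRatClass_injective (Y := ComplexPoints Y) i ?_)⟩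
  change ofRatClass (ComplexPoints Y) i (ψ.toLinearMap v) = ofRatClass (ComplexPoints Y) i (φ.toLinearMap v)
  rw [hψ v, hφ v]

/-! ### §2 From a morphism into the integer Tate twist to the Hodge class -/

/-- **Every morphism of Hodge structures `φ : Hᵃ(Z) → Hⁱ(Y)(r)` (`r : ℤ` of any sign, `n + r = c`, `i + j = 2c`, `a + j = 2n`) is `φ_t` for a Hodge class `t` of `Hⁱ(Y;ℚ) ⊗ Hʲ(Z;ℚ)`:
`(crossMap t ⊗ 1)_*(v ⊗ 1) = φ(v) ⊗ 1`** (g31-#1 `HodgeModel.exists_carrier_of_hom_int` gives the carrier map — rational, of bidegree `(r, r)`, zero below — and g30-#14 the Hodge class).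
[cite: VoisinHodgeI2002, §7.3.1 Def. 7.22, §7.3.2, §11.3.3 Lemma 11.41 and p. 286] [cite: DeligneHodgeII1971, 2.1.13–2.1.14] -/
theorem BettiUniverse.exists_mem_hodgeClasses_corrAction_crossMap_eq_ofRatClass_hom_int (hHD : exists_isReal_hodgeModel) (hY : IsSmoothProjective m Y) (hZ : IsSmoothProjective n Z) {c i j a : ℕ}
    {r : ℤ} (hij : i + j = 2 * c) (haj : a + j = 2 * n) (hab : a + 2 * c = i + 2 * n) (hr : ((n : ℕ) : ℤ) + r = ((c : ℕ) : ℤ)) (hw : ((i : ℕ) : ℤ) - 2 * r = ((a : ℕ) : ℤ))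
    (φ : HodgeStructure.Hom (BettiUniverse.hodge hHD hZ a) (((BettiUniverse.hodge hHD hY i).tateTwist r).cast hw)) :
    ∃ t ∈ (BettiUniverse.kunnethSummand hHD hY hZ (2 * c) ⟨(i, j), mem_antidiagonal.2 hij⟩).hodgeClasses c,
      ∀ v, corrAction complexOrientationFamily hY hZ hab (ofRatClass (ComplexPoints (Y ⊗ Z)) (2 * c) (BettiUniverse.crossMap Y Z hij t)) (ofRatClass (ComplexPoints Z) a v) =
        ofRatClass (ComplexPoints Y) i (φ.toLinearMap v) := by
  have hI := hodgePQ_independent_of_hodgeModel_holds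
  obtain ⟨f, hfφ, hR, hSm, hVm⟩ := HodgeModel.exists_carrier_of_hom_int hZ hY (BettiUniverse.realHodgeModel hHD hZ) (BettiUniverse.realHodgeModel_isHodgeSymmetric hHD hZ)
    (BettiUniverse.realHodgeModel hHD hY) (BettiUniverse.realHodgeModel_isHodgeSymmetric hHD hY) (show ((a : ℕ) : ℤ) + 2 * r = ((i : ℕ) : ℤ) by omega)
    (((BettiUniverse.hodge hHD hY i).tateTwist r).cast hw)
    (HodgeModel.piece_tateTwist_cast_int hY (BettiUniverse.realHodgeModel hHD hY) (BettiUniverse.realHodgeModel_isHodgeSymmetric hHD hY) hw) φ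
  -- the carrier map is type-shifting in the sense of g30-#14
  have hS : ∀ (p q : ℕ), p + q = a → ∀ u : complexBetti Z a, IsOfHodgeType n Z a p q u → ∀ p' q' : ℕ, p' + n = p + c → q' + n = q + c → IsOfHodgeType m Y i p' q' (f u) := by
    intro p q hpq u hu p' q' hp hq
    obtain ⟨A', hA'⟩ := hu
    exact ⟨_, hSm p q hpq u (hI n Z hZ A' _ a p q u hA') p' q' (by omega) (by omega)⟩
  have hV : ∀ (p q : ℕ), p + q = a → ∀ u : complexBetti Z a, IsOfHodgeType n Z a p q u → p + c < n ∨ q + c < n → f u = 0 := by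
    intro p q hpq u hu hlt
    obtain ⟨A', hA'⟩ := hu
    exact hVm p q hpq u (hI n Z hZ A' _ a p q u hA') (by omega)
  obtain ⟨t, ht, htf⟩ := BettiUniverse.exists_mem_hodgeClasses_corrAction_crossMap_eq_of_typeShift hHD hY hZ hij haj hab f hR hS hV
  refine ⟨t, ht, fun v ↦ ?_⟩
  have h := hfφ (1 ⊗ₜ v)
  rw [LinearMap.baseChange_tmul, ofRatClassBaseChange_tmul, ofRatClassBaseChange_tmul, one_smul, one_smul] at h
  rw [htf, h]

/-- **… and the Hodge class `t` is unique** (a class of the summand is determined by its action, g30-#2; the rational classes span). [cite: VoisinHodgeI2002, §7.1.1, §11.3.3 Lemma 11.41 and p. 286] -/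
theorem BettiUniverse.existsUnique_mem_hodgeClasses_corrAction_crossMap_eq_ofRatClass_hom_int (hHD : exists_isReal_hodgeModel) (hY : IsSmoothProjective m Y) (hZ : IsSmoothProjective n Z)
    {c i j a : ℕ} {r : ℤ} (hij : i + j = 2 * c) (haj : a + j = 2 * n) (hab : a + 2 * c = i + 2 * n) (hr : ((n : ℕ) : ℤ) + r = ((c : ℕ) : ℤ)) (hw : ((i : ℕ) : ℤ) - 2 * r = ((a : ℕ) : ℤ))
    (φ : HodgeStructure.Hom (BettiUniverse.hodge hHD hZ a) (((BettiUniverse.hodge hHD hY i).tateTwist r).cast hw)) :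
    ∃! t, t ∈ (BettiUniverse.kunnethSummand hHD hY hZ (2 * c) ⟨(i, j), mem_antidiagonal.2 hij⟩).hodgeClasses c ∧
      ∀ v, corrAction complexOrientationFamily hY hZ hab (ofRatClass (ComplexPoints (Y ⊗ Z)) (2 * c) (BettiUniverse.crossMap Y Z hij t)) (ofRatClass (ComplexPoints Z) a v) =
        ofRatClass (ComplexPoints Y) i (φ.toLinearMap v) := by
  obtain ⟨t, ht, htφ⟩ := BettiUniverse.exists_mem_hodgeClasses_corrAction_crossMap_eq_ofRatClass_hom_int hHD hY hZ hij haj hab hr hw φ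
  refine ⟨t, ⟨ht, htφ⟩, fun t' ht' ↦ BettiUniverse.corrAction_crossMap_injective complexOrientationFamily hY hZ hij haj hab ?_⟩
  refine LinearMap.ext_on_range (BettiUniverse.span_range_ofRatClass_eq_top hZ a) fun v ↦ ?_
  rw [ht'.2 v, htφ v]

/-! ### §3 The dimension identity and the duality, all signs -/

/-- **`dim_ℚ Hdgᶜ(Hⁱ(Y) ⊗ Hʲ(Z)) = dim_ℚ Hom_HS(Hᵃ(Z), Hⁱ(Y)(r))`** for `i + j = 2c`, `a + j = 2n`, `n + r = c` with `r : ℤ` of any sign: `t ↦ φ_t` (§1) is ℚ-linear, injective (g30-#2) and surjective (§2).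
[cite: VoisinHodgeI2002, §11.3.3 Thm. 11.38–11.40, Lemma 11.41 and pp. 285–287] [cite: DeligneHodgeII1971, 2.1.13–2.1.14] -/
theorem BettiUniverse.finrank_hodgeClasses_kunnethSummand_eq_finrank_hom_tateTwist_int (hHD : exists_isReal_hodgeModel) (hY : IsSmoothProjective m Y) (hZ : IsSmoothProjective n Z) {c i j a : ℕ}
    {r : ℤ} (hij : i + j = 2 * c) (haj : a + j = 2 * n) (hab : a + 2 * c = i + 2 * n) (hr : ((n : ℕ) : ℤ) + r = ((c : ℕ) : ℤ)) (hw : ((i : ℕ) : ℤ) - 2 * r = ((a : ℕ) : ℤ)) :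
    Module.finrank ℚ ↥((BettiUniverse.kunnethSummand hHD hY hZ (2 * c) ⟨(i, j), mem_antidiagonal.2 hij⟩).hodgeClasses c) =
      Module.finrank ℚ (HodgeStructure.Hom (BettiUniverse.hodge hHD hZ a) (((BettiUniverse.hodge hHD hY i).tateTwist r).cast hw)) := by
  classical
  -- the map `t ↦ φ_t`
  choose Φ₀ hΦ₀ using fun t : ↥((BettiUniverse.kunnethSummand hHD hY hZ (2 * c) ⟨(i, j), mem_antidiagonal.2 hij⟩).hodgeClasses c) ↦
    BettiUniverse.exists_hom_tateTwist_int_of_mem_hodgeClasses_kunnethSummand hHD hY hZ hij hab hr hw t.2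
  have hext : ∀ (ψ ψ' : HodgeStructure.Hom (BettiUniverse.hodge hHD hZ a) (((BettiUniverse.hodge hHD hY i).tateTwist r).cast hw)),
      (∀ v, ofRatClass (ComplexPoints Y) i (ψ.toLinearMap v) = ofRatClass (ComplexPoints Y) i (ψ'.toLinearMap v)) → ψ = ψ' :=
    fun ψ ψ' h ↦ HodgeStructure.Hom.toLinearMap_injective (LinearMap.ext fun v ↦ ofRatClass_injective (Y := ComplexPoints Y) i (h v))
  let Φ : ↥((BettiUniverse.kunnethSummand hHD hY hZ (2 * c) ⟨(i, j), mem_antidiagonal.2 hij⟩).hodgeClasses c) →ₗ[ℚ]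
      HodgeStructure.Hom (BettiUniverse.hodge hHD hZ a) (((BettiUniverse.hodge hHD hY i).tateTwist r).cast hw) :=
    { toFun := Φ₀
      map_add' := fun t t' ↦ hext _ _ fun v ↦ by
        change ofRatClass (ComplexPoints Y) i ((Φ₀ (t + t')).toLinearMap v) = ofRatClass (ComplexPoints Y) i ((Φ₀ t).toLinearMap v + (Φ₀ t').toLinearMap v)
        rw [map_add, hΦ₀, hΦ₀, hΦ₀, Submodule.coe_add, map_add, map_add, map_add, LinearMap.add_apply]
      map_smul' := fun q t ↦ hext _ _ fun v ↦ by
        change ofRatClass (ComplexPoints Y) i ((Φ₀ (q • t)).toLinearMap v) = ofRatClass (ComplexPoints Y) i (q • (Φ₀ t).toLinearMap v)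
        rw [hΦ₀, Submodule.coe_smul, map_smul, ofRatClass_smul, map_smul, LinearMap.smul_apply, ofRatClass_smul, hΦ₀] }
  have hΦ : ∀ t, Φ t = Φ₀ t := fun _ ↦ rfl
  refine (LinearEquiv.ofBijective Φ ⟨?_, fun φ ↦ ?_⟩).finrank_eq
  · rw [← LinearMap.ker_eq_bot, LinearMap.ker_eq_bot']
    intro t ht
    apply Subtype.ext
    refine BettiUniverse.eq_zero_of_corrAction_crossMap_eq_zero complexOrientationFamily hY hZ hij haj hab ?_
    refine LinearMap.ext_on_range (BettiUniverse.span_range_ofRatClass_eq_top hZ a) fun v ↦ ?_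
    rw [← hΦ₀ t v, ← hΦ t, ht]
    change ofRatClass (ComplexPoints Y) i 0 = 0
    rw [map_zero]
  · obtain ⟨t, ht, htφ⟩ := BettiUniverse.exists_mem_hodgeClasses_corrAction_crossMap_eq_ofRatClass_hom_int hHD hY hZ hij haj hab hr hw φ
    exact ⟨⟨t, ht⟩, hext _ _ fun v ↦ by rw [hΦ, hΦ₀, htφ v]⟩

/-- **Duality, all signs: `dim_ℚ Hom_HS(Hⁱ(Y), Hʲ(Z)(s)) = dim_ℚ Hom_HS(Hᵃ(Z), Hⁱ(Y)(r))`** for `i + j = 2c`, `a + j = 2n`, `n + r = c`, `j − 2s = i` (`r`, `s : ℤ`) — both count the Hodge classes of `Hⁱ(Y) ⊗ Hʲ(Z)`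
(the tree's `finrank_hodgeClasses_tensor_hodge_eq_finrank_hom_tateTwist` and §3): Poincaré duality `Hʲ(Z) ≅ H^{2n−j}(Z)^∨(−n)` read through Lemma 11.41.
[cite: VoisinHodgeI2002, §11.3.3 Thm. 11.38–11.40, Lemma 11.41 and pp. 285–287] [cite: HatcherAT2002, §3.3 Prop. 3.38] -/
theorem BettiUniverse.finrank_hom_tateTwist_eq_finrank_hom_tateTwist_int_swap (hHD : exists_isReal_hodgeModel) (hY : IsSmoothProjective m Y) (hZ : IsSmoothProjective n Z) {c i j a : ℕ} {r s : ℤ}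
    (hij : i + j = 2 * c) (haj : a + j = 2 * n) (hab : a + 2 * c = i + 2 * n) (hr : ((n : ℕ) : ℤ) + r = ((c : ℕ) : ℤ)) (hw : ((i : ℕ) : ℤ) - 2 * r = ((a : ℕ) : ℤ))
    (hs : ((j : ℕ) : ℤ) - 2 * s = ((i : ℕ) : ℤ)) :
    Module.finrank ℚ (HodgeStructure.Hom (BettiUniverse.hodge hHD hY i) (((BettiUniverse.hodge hHD hZ j).tateTwist s).cast hs)) =
      Module.finrank ℚ (HodgeStructure.Hom (BettiUniverse.hodge hHD hZ a) (((BettiUniverse.hodge hHD hY i).tateTwist r).cast hw)) := by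
  have e := BettiUniverse.finrank_hodgeClasses_tensor_hodge_eq_finrank_hom_tateTwist hHD hY hZ i j (s := s) hs
  rw [show ((i : ℕ) : ℤ) + s = ((c : ℕ) : ℤ) by omega] at e
  rw [← e, ← BettiUniverse.finrank_hodgeClasses_kunnethSummand_eq_finrank_hom_tateTwist_int hHD hY hZ hij haj hab hr hw]
  rfl

/-! ### §4 `HC(Y × Z)` ⇒ morphisms `Hᵃ(Z) → Hⁱ(Y)(r)`, any `r : ℤ`, are actions of algebraic classes -/

/-- **`HC(Y × Z)` ⇒ every morphism of Hodge structures `φ : Hᵃ(Z) → Hⁱ(Y)(r)` (`r : ℤ` of any sign, `n + r = c`, `i + j = 2c`, `a + j = 2n`) is the action of a rational ALGEBRAIC class of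
`H^{2c}(Y × Z)`: `(γ ⊗ 1)_*(v ⊗ 1) = φ(v) ⊗ 1`** (`γ = crossMap t`, `t` the Hodge class of the summand with `φ = φ_t`, algebraic by `HC`; complex orientations).
[cite: VoisinHodgeI2002, §7.3.1 Def. 7.22, §11.3.3 Lemma 11.41 and pp. 285–287] [cite: Voisin2025, §3.2.1 (12)–(14), Prop. 3.8 and Cor. 3.9] [cite: Deligne2000, §1] -/
theorem BettiUniverse.exists_algebraic_corrAction_eq_ofRatClass_hom_int_of_hodgeConjectureFor (hHD : exists_isReal_hodgeModel) (hY : IsSmoothProjective m Y) (hZ : IsSmoothProjective n Z)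
    (hHC : HodgeConjectureFor (m + n) (Y ⊗ Z)) {c i j a : ℕ} {r : ℤ} (hij : i + j = 2 * c) (haj : a + j = 2 * n) (hab : a + 2 * c = i + 2 * n) (hr : ((n : ℕ) : ℤ) + r = ((c : ℕ) : ℤ))
    (hw : ((i : ℕ) : ℤ) - 2 * r = ((a : ℕ) : ℤ)) (φ : HodgeStructure.Hom (BettiUniverse.hodge hHD hZ a) (((BettiUniverse.hodge hHD hY i).tateTwist r).cast hw)) :
    ∃ γ : bettiCohomology (Y ⊗ Z) (2 * c), ofRatClass (ComplexPoints (Y ⊗ Z)) (2 * c) γ ∈ algebraicClasses (Y ⊗ Z) c ∧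
      ∀ v, corrAction complexOrientationFamily hY hZ hab (ofRatClass (ComplexPoints (Y ⊗ Z)) (2 * c) γ) (ofRatClass (ComplexPoints Z) a v) = ofRatClass (ComplexPoints Y) i (φ.toLinearMap v) := by
  obtain ⟨t, ht, htφ⟩ := BettiUniverse.exists_mem_hodgeClasses_corrAction_crossMap_eq_ofRatClass_hom_int hHD hY hZ hij haj hab hr hw φ
  exact ⟨_, hHC.2 c _ (isRationalClass_ofRatClass _) ((BettiUniverse.mem_hodgeClasses_kunnethSummand_iff_isOfHodgeType hHD hY hZ hij t).1 ht), htφ⟩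

/-! ### §5 «Hodge classes act as algebraic classes» ⟺ «morphisms into `H(r)` are induced by algebraic classes» -/

/-- **For one Künneth piece `Hⁱ(Y) ⊗ Hʲ(Z) ⊂ H^{2c}(Y × Z)` (`a + j = 2n`, `n + r = c`, `r : ℤ`): every Hodge class of the summand acts on `Hᵃ(Z;ℂ)` as some rational algebraic class of
`H^{2c}(Y × Z)` does IFF every morphism of Hodge structures `φ : Hᵃ(Z) → Hⁱ(Y)(r)` is induced by some rational algebraic class: `(γ ⊗ 1)_*(v ⊗ 1) = φ(v) ⊗ 1`** (Lemma 11.41 packaged, §1–§2; the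
rational classes span `Hᵃ(Z;ℂ)`). [cite: VoisinHodgeI2002, §7.3.1 Def. 7.22, §11.3.3 Lemma 11.41 and pp. 285–287] [cite: Voisin2025, §3.2.1 (12)–(14), Prop. 3.8 and Cor. 3.9] -/
theorem BettiUniverse.forall_hodgeClasses_exists_algebraic_corrAction_eq_iff_forall_hom_tateTwist_int (hHD : exists_isReal_hodgeModel) (hY : IsSmoothProjective m Y) (hZ : IsSmoothProjective n Z)
    {c i j a : ℕ} {r : ℤ} (hij : i + j = 2 * c) (haj : a + j = 2 * n) (hab : a + 2 * c = i + 2 * n) (hr : ((n : ℕ) : ℤ) + r = ((c : ℕ) : ℤ)) (hw : ((i : ℕ) : ℤ) - 2 * r = ((a : ℕ) : ℤ)) :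
    (∀ t ∈ (BettiUniverse.kunnethSummand hHD hY hZ (2 * c) ⟨(i, j), mem_antidiagonal.2 hij⟩).hodgeClasses c,
        ∃ γ : bettiCohomology (Y ⊗ Z) (2 * c), ofRatClass (ComplexPoints (Y ⊗ Z)) (2 * c) γ ∈ algebraicClasses (Y ⊗ Z) c ∧
          corrAction complexOrientationFamily hY hZ hab (ofRatClass (ComplexPoints (Y ⊗ Z)) (2 * c) γ) =
            corrAction complexOrientationFamily hY hZ hab (ofRatClass (ComplexPoints (Y ⊗ Z)) (2 * c) (BettiUniverse.crossMap Y Z hij t))) ↔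
      ∀ φ : HodgeStructure.Hom (BettiUniverse.hodge hHD hZ a) (((BettiUniverse.hodge hHD hY i).tateTwist r).cast hw),
        ∃ γ : bettiCohomology (Y ⊗ Z) (2 * c), ofRatClass (ComplexPoints (Y ⊗ Z)) (2 * c) γ ∈ algebraicClasses (Y ⊗ Z) c ∧
          ∀ v, corrAction complexOrientationFamily hY hZ hab (ofRatClass (ComplexPoints (Y ⊗ Z)) (2 * c) γ) (ofRatClass (ComplexPoints Z) a v) = ofRatClass (ComplexPoints Y) i (φ.toLinearMap v) := by
  constructor
  · intro h φ
    obtain ⟨t, ht, htφ⟩ := BettiUniverse.exists_mem_hodgeClasses_corrAction_crossMap_eq_ofRatClass_hom_int hHD hY hZ hij haj hab hr hw φ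
    obtain ⟨γ, hγ, hact⟩ := h t ht
    exact ⟨γ, hγ, fun v ↦ by rw [hact, htφ v]⟩
  · intro h t ht
    obtain ⟨φ, hφ⟩ := BettiUniverse.exists_hom_tateTwist_int_of_mem_hodgeClasses_kunnethSummand hHD hY hZ hij hab hr hw ht
    obtain ⟨γ, hγ, hact⟩ := h φ
    refine ⟨γ, hγ, LinearMap.ext_on_range (BettiUniverse.span_range_ofRatClass_eq_top hZ a) fun v ↦ ?_⟩
    rw [hact v, hφ v]

/-- **`HC(Y × Z)` makes both sides of §5 true** (recorded for convenience: the ∃-form on Hodge classes). [cite: Voisin2025, §3.2.1 (12)–(14), Prop. 3.8 and Cor. 3.9] [cite: Deligne2000, §1] -/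
theorem BettiUniverse.forall_hom_tateTwist_int_exists_algebraic_of_hodgeConjectureFor (hHD : exists_isReal_hodgeModel) (hY : IsSmoothProjective m Y) (hZ : IsSmoothProjective n Z)
    (hHC : HodgeConjectureFor (m + n) (Y ⊗ Z)) {c i j a : ℕ} {r : ℤ} (hij : i + j = 2 * c) (haj : a + j = 2 * n) (hab : a + 2 * c = i + 2 * n) (hr : ((n : ℕ) : ℤ) + r = ((c : ℕ) : ℤ))
    (hw : ((i : ℕ) : ℤ) - 2 * r = ((a : ℕ) : ℤ)) :
    ∀ φ : HodgeStructure.Hom (BettiUniverse.hodge hHD hZ a) (((BettiUniverse.hodge hHD hY i).tateTwist r).cast hw),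
      ∃ γ : bettiCohomology (Y ⊗ Z) (2 * c), ofRatClass (ComplexPoints (Y ⊗ Z)) (2 * c) γ ∈ algebraicClasses (Y ⊗ Z) c ∧
        ∀ v, corrAction complexOrientationFamily hY hZ hab (ofRatClass (ComplexPoints (Y ⊗ Z)) (2 * c) γ) (ofRatClass (ComplexPoints Z) a v) = ofRatClass (ComplexPoints Y) i (φ.toLinearMap v) :=
  fun φ ↦ BettiUniverse.exists_algebraic_corrAction_eq_ofRatClass_hom_int_of_hodgeConjectureFor hHD hY hZ hHC hij haj hab hr hw φ

/-! ### §6 Curves times threefolds: the genuine `Hom_HS(H³T, H¹C(−1))` criterion; curves times `n`-folds -/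

/-- **`HC(C × T)` for a smooth projective curve `C` and threefold `T` IFF every morphism of `ℚ`-Hodge structures `φ : H³(T) → H¹(C)(−1)` is induced by a rational algebraic class `γ` of
`H⁴(C × T)`: `(γ ⊗ 1)_*(v ⊗ 1) = φ(v) ⊗ 1` for all `v ∈ H³(T;ℚ)`** (complex orientations; the target is the Tate twist `H¹(C)(−1)`, weight `3`, transported along `1 − 2·(−1) = 3`).  These `φ` are the
morphisms of Hodge structures underlying the homomorphisms of intermediate Jacobians `J²(T) → J(C)`; the only piece of `H⁴(C × T)` not accounted for by `HC` in dimension `≤ 3`, Lefschetz `(1,1)`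
and hard Lefschetz is `H¹(C) ⊗ H³(T)` (g30-#7).  [cite: VoisinHodgeI2002, §7.3.1 Def. 7.22, §7.3.2, §11.3.3 Thm. 11.38–11.40, Lemma 11.41 and pp. 285–287, §12.1] [cite: Voisin2025, §3.2.1 (12)–(14), Prop. 3.8 and Cor. 3.9]
[cite: Deligne2000, §1] -/
theorem BettiUniverse.hodgeConjectureFor_curve_tensor_threefold_iff_forall_hom_tateTwist_exists_algebraic (hHD : exists_isReal_hodgeModel) (hC : IsSmoothProjective 1 C) (hT : IsSmoothProjective 3 T)
    (hCT : IsSmoothProjective d (C ⊗ T)) (hw : (((1 : ℕ) : ℕ) : ℤ) - 2 * (-1 : ℤ) = (((3 : ℕ) : ℕ) : ℤ)) :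
    HodgeConjectureFor d (C ⊗ T) ↔
      ∀ φ : HodgeStructure.Hom (BettiUniverse.hodge hHD hT 3) (((BettiUniverse.hodge hHD hC 1).tateTwist (-1 : ℤ)).cast hw),
        ∃ γ : bettiCohomology (C ⊗ T) (2 * 2), ofRatClass (ComplexPoints (C ⊗ T)) (2 * 2) γ ∈ algebraicClasses (C ⊗ T) 2 ∧
          ∀ v, corrAction complexOrientationFamily hC hT (rfl : 3 + 2 * 2 = 1 + 2 * 3) (ofRatClass (ComplexPoints (C ⊗ T)) (2 * 2) γ) (ofRatClass (ComplexPoints T) 3 v) =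
            ofRatClass (ComplexPoints C) 1 (φ.toLinearMap v) := by
  rw [BettiUniverse.hodgeConjectureFor_curve_tensor_threefold_iff_forall_exists_corrAction_eq complexOrientationFamily hHD hC hT hCT]
  exact BettiUniverse.forall_hodgeClasses_exists_algebraic_corrAction_eq_iff_forall_hom_tateTwist_int hHD hC hT (show 1 + 3 = 2 * 2 by norm_num) (show 3 + 3 = 2 * 3 by norm_num)
    (rfl : 3 + 2 * 2 = 1 + 2 * 3) (by norm_num) hw

/-- **`HC(C × Z)` for a curve `C` and an `n`-fold `Z` with `HC(Z)` IFF for every odd `j` with `3 ≤ j ≤ n` (`1 + j = 2c`, `a + j = 2n`; twist `r = c − n ≤ 0`) every morphism of Hodge structures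
`φ : Hᵃ(Z) → H¹(C)(r)` is induced by a rational algebraic class of `H^{2c}(C × Z)`** (g30-#7's ∃-form on the pieces `H¹(C) ⊗ Hʲ(Z)` + §5). [cite: VoisinHodgeI2002, §7.3.1 Def. 7.22, §11.3.3 Lemma 11.41 and pp. 285–287, §12.1]
[cite: Voisin2025, §3.2.1 (12)–(14), Prop. 3.8 and Cor. 3.9] [cite: Deligne2000, §1] -/
theorem BettiUniverse.hodgeConjectureFor_curve_tensor_iff_forall_hom_tateTwist_exists_algebraic (hHD : exists_isReal_hodgeModel) (hC : IsSmoothProjective 1 C) (hZ : IsSmoothProjective n Z)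
    (hCZ : IsSmoothProjective d (C ⊗ Z)) (hHCZ : HodgeConjectureFor n Z) :
    HodgeConjectureFor d (C ⊗ Z) ↔
      ∀ (c j a : ℕ) (r : ℤ) (_h1j : 1 + j = 2 * c) (hab : a + 2 * c = 1 + 2 * n) (_hr : ((n : ℕ) : ℤ) + r = ((c : ℕ) : ℤ)) (hw : (((1 : ℕ) : ℕ) : ℤ) - 2 * r = ((a : ℕ) : ℤ)), 3 ≤ j → j ≤ n →
        ∀ φ : HodgeStructure.Hom (BettiUniverse.hodge hHD hZ a) (((BettiUniverse.hodge hHD hC 1).tateTwist r).cast hw),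
          ∃ γ : bettiCohomology (C ⊗ Z) (2 * c), ofRatClass (ComplexPoints (C ⊗ Z)) (2 * c) γ ∈ algebraicClasses (C ⊗ Z) c ∧
            ∀ v, corrAction complexOrientationFamily hC hZ hab (ofRatClass (ComplexPoints (C ⊗ Z)) (2 * c) γ) (ofRatClass (ComplexPoints Z) a v) = ofRatClass (ComplexPoints C) 1 (φ.toLinearMap v) := by
  rw [BettiUniverse.hodgeConjectureFor_curve_tensor_iff_forall_exists_corrAction_eq complexOrientationFamily hHD hC hZ hCZ hHCZ]
  constructor
  · intro h c j a r h1j hab hr hw h3 hjn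
    exact (BettiUniverse.forall_hodgeClasses_exists_algebraic_corrAction_eq_iff_forall_hom_tateTwist_int hHD hC hZ h1j (by omega) hab hr hw).1 (h c j a h1j hab h3 hjn)
  · intro h c j a h1j hab h3 hjn
    have hw : (((1 : ℕ) : ℕ) : ℤ) - 2 * (((c : ℕ) : ℤ) - ((n : ℕ) : ℤ)) = ((a : ℕ) : ℤ) := by push_cast; omega
    exact (BettiUniverse.forall_hodgeClasses_exists_algebraic_corrAction_eq_iff_forall_hom_tateTwist_int hHD hC hZ h1j (by omega) hab (by omega) hw).2
      (h c j a (((c : ℕ) : ℤ) - ((n : ℕ) : ℤ)) h1j hab (by omega) hw h3 hjn)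

end Literature.AlgebraicGeometry.HodgeTheory

end
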